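import Summits.Ventures.DiscreteObjects.UnitDistance.PadicReduction
import Summits.Ventures.DiscreteObjects.UnitDistance.PadicCriterion
import Summits.Ventures.DiscreteObjects.UnitDistance.PlaneSqrt47Bounds
import Summits.Ventures.DiscreteObjects.UnitDistance.PlaneSqrt311Bounds
import Summits.Ventures.DiscreteObjects.UnitDistance.PlaneSqrt335Bounds
import Summits.Ventures.DiscreteObjects.UnitDistance.OddCycles
import Mathlib.NumberTheory.Padics.RingHoms
import HarnessLib

/-!
# Reduction modulo ALL powers of an unramified prime: `χ(K²) ≤ χ(unitCircleGraph (ℤ/p^k))` for `K ⊂ ℚ_p`, `p ≡ 3 (mod 4)`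
(cell `pub-namedobj`, target (U), seat udg g19)

Framing (verbatim for the cell): lottery ticket; floor = certified bounds/negative ranges.

Madore (arXiv:1509.07023, Prop. 3.5) observes that the reduction principle works modulo any power of the prime: if a valuation
ring `O ⊆ K` has `−1` a non-square in its residue field, unit vectors of `K²` are `O`-integral (`ValuationRingReduction.lean`), so
ANY ring homomorphism `ρ : O →+* B` to a nontrivial commutative ring — not only the residue map — turns a unit-distance graph
coordinatised in `K²` into a subgraph-up-to-homomorphism of `unitCircleGraph B`.  With `O = ℤ_p ⊂ ℚ_p` and `ρ = ℤ_p → ℤ/p^k`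
(Mathlib's `PadicInt.toZModPow`) this is the ORDER-`k` bound `χ(ℚ_p²) ≤ χ(G_k(p))`, `G_k(p) := unitCircleGraph (ZMod (p^k)) =
Cay((ℤ/p^k)², {a² + b² = 1})`, for every `k ≥ 1`; the tree so far had `k = 1` (`PadicReduction.lean`) and the remark that `k = 2`
never helps at a RAMIFIED degree-one prime (`SecondOrderReduction.lean`).

WHY (the cell's open quadratic rows).  The rows `χ(ℚ(√d)²) ∈ {4, 5}` for `d = 47, 311, 335` (and `∈ [3, 5]` for `383`) all have
`√d ∈ ℚ₁₁` (`47 ≡ 5²`, `311 ≡ 5²`, `335 ≡ 4²`, `383 ≡ 3²`), and `47, 311` also have `√d ∈ ℚ₁₉`; the order-one graphs need five colours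
(`χ(UD(𝔽₁₁²)) = χ(UD(𝔽₁₉²)) = 5`, kernel), and so does `G₂(11)` (udg g3, certificate).  By this file, a proper `4`-colouring of ONE
graph `G_k(11)` (`k ≥ 3`) or `G_k(19)` (`k ≥ 2`) would make the rows `47, 311` (and `335`, `383 → {3,4}` for `11`) EXACT with value `4`
(`chromaticNumber_plane_sqrt47_eq_four_of_zmodPow` etc. below, stated as implications).  Seat udg g19's exact search (hub, HOME
pub-namedobj-udg-g19/FAMILIES-U19.md): every loop-free translation quotient of `G₃(11)` other than `G₃(11)` itself, and the orbit
graphs of `G₃(11)` and `G₂(19)` under the rotations `≡ 1 (mod p)`, need five colours; `G₃(11)` (1,771,561 vertices) and `G₂(19)`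
(130,321 vertices) themselves are undecided.  The Hoffman ratio `−λ_min/(d − λ_min)` of `UD(𝔽_p²)` bounds the independence ratio
of every `G_k(p)` (udg g3's spectral theorem: the ratio is the same at all orders); it is `< 1/4` for `p = 23` and for `43 ≤ p ≤ 71`
(and `|λ| ≤ 2√p` keeps it below `1/4` for every `p ≥ 37`), and `0.249997 < 1/4` for `p = 31` (`λ_min = −10.66651…`) — so among the
primes `p ≡ 3 (mod 4)` only `7` (value `4` already), `11` and `19` can have a `4`-colourable `G_k(p)`: `11` and `19` are the only primes at
which a higher-order reduction could close these rows at `4` (floating-point spectra, not kernel facts: HOME pub-namedobj-udg-g19/FAMILIES-U19.md).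
THE `p`-ADIC PLANES (last section): combining the order-one upper bounds of `PadicReduction.lean` with the cell's quadratic witnesses
embedded along `ℚ(√d) ↪ ℚ_p` (Hensel): `χ(unitCircleGraph ℚ₃) = 3`, `χ(unitCircleGraph ℚ₇) = 4`, and `4 ≤ χ ≤ 5` for `ℚ₁₁`, `ℚ₁₉`
(kernel; the last two are the open questions on which the rows `47, 311, 335` hinge: `chromaticNumber_plane_sqrt_47_311_335_eq_four_of_padic`).
Nothing here is cited as new mathematics: the principle is Madore's; the content is the formalisation and the conditional row statements.
-/

noncomputable section

namespace Summit.Ventures.DiscreteObjects.UnitDistance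

open SimpleGraph IsLocalRing IntermediateField
open scoped IntermediateField

/-! ## The reduction homomorphism through an arbitrary ring homomorphism of the valuation ring -/

section General

variable {K : Type*} [Field K] (O : ValuationSubring K)
variable {V : Type*} {G : SimpleGraph V} (p : V → K × K)

/-- The centred coordinates (`centredCoord`, differences to a base vertex of the component) as elements of `O × O`. -/
noncomputable def centredCoordO (hO : ∀ z : ResidueField O, z ^ 2 ≠ -1)
    (hadj : ∀ ⦃v w : V⦄, G.Adj v w → ((p v).1 - (p w).1) ^ 2 + ((p v).2 - (p w).2) ^ 2 = 1) (v : V) : O × O :=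
  (⟨(centredCoord G p v).1, (centredCoord_mem O p hO hadj v).1⟩, ⟨(centredCoord G p v).2, (centredCoord_mem O p hO hadj v).2⟩)

/-- Adjacent vertices have `O`-valued centred coordinates at unit distance IN `O`. -/
theorem centredCoordO_adj (hO : ∀ z : ResidueField O, z ^ 2 ≠ -1)
    (hadj : ∀ ⦃v w : V⦄, G.Adj v w → ((p v).1 - (p w).1) ^ 2 + ((p v).2 - (p w).2) ^ 2 = 1) ⦃v w : V⦄ (hvw : G.Adj v w) :
    ((centredCoordO O p hO hadj v).1 - (centredCoordO O p hO hadj w).1) ^ 2 +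
      ((centredCoordO O p hO hadj v).2 - (centredCoordO O p hO hadj w).2) ^ 2 = 1 := by
  have hb : baseVertex G w = baseVertex G v := (baseVertex_eq_of_adj hvw).symm
  have d1 : (centredCoord G p v).1 - (centredCoord G p w).1 = (p v).1 - (p w).1 := by
    simp only [centredCoord, Prod.fst_sub, hb]; ring
  have d2 : (centredCoord G p v).2 - (centredCoord G p w).2 = (p v).2 - (p w).2 := by
    simp only [centredCoord, Prod.snd_sub, hb]; ring
  apply Subtype.ext
  have h := hadj hvw
  rw [← d1, ← d2] at h
  simpa [centredCoordO] using h

/-- THE ORDER-FREE REDUCTION HOMOMORPHISM (Madore Prop. 3.1/3.5): with `O ⊆ K` a valuation ring whose residue field has `−1` a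
non-square, every graph coordinatised in `K²` with unit-distance edges maps homomorphically to `unitCircleGraph B` along ANY ring
homomorphism `ρ : O →+* B` into a nontrivial commutative ring (centre each component at a base vertex, then apply `ρ`). -/
noncomputable def homUnitCircleGraphOfValuationSubringRingHom (hO : ∀ z : ResidueField O, z ^ 2 ≠ -1)
    (hadj : ∀ ⦃v w : V⦄, G.Adj v w → ((p v).1 - (p w).1) ^ 2 + ((p v).2 - (p w).2) ^ 2 = 1)
    {B : Type*} [CommRing B] [Nontrivial B] (ρ : O →+* B) : G →g unitCircleGraph B :=
  homUnitCircleGraphOfRingHom (centredCoordO O p hO hadj) (centredCoordO_adj O p hO hadj) ρ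

/-- Colouring form: `G` is `n`-colourable whenever `unitCircleGraph B` is, for any nontrivial `B` receiving a ring homomorphism
from the valuation ring `O` (residue field with `−1` a non-square).  `B = O/𝔪^k` gives Madore's Prop. 3.5 at every order `k`. -/
theorem colorable_of_valuationSubring_ringHom (hO : ∀ z : ResidueField O, z ^ 2 ≠ -1)
    (hadj : ∀ ⦃v w : V⦄, G.Adj v w → ((p v).1 - (p w).1) ^ 2 + ((p v).2 - (p w).2) ^ 2 = 1)
    {B : Type*} [CommRing B] [Nontrivial B] (ρ : O →+* B) {n : ℕ} (hB : (unitCircleGraph B).Colorable n) :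
    G.Colorable n :=
  hB.of_hom (homUnitCircleGraphOfValuationSubringRingHom O p hO hadj ρ)

end General

/-! ## `O = ℤ_p ⊂ ℚ_p`, `ρ = ℤ_p → ℤ/p^k` -/

section Padic

variable (p : ℕ) [hp : Fact p.Prime]

/-- `ZMod (p^k)` is nontrivial for `k ≠ 0`. -/
theorem fact_one_lt_prime_pow {k : ℕ} (hk : k ≠ 0) : Fact (1 < p ^ k) :=
  ⟨Nat.one_lt_pow hk hp.out.one_lt⟩

/-- The ring homomorphism from the `p`-adic valuation subring (`= ℤ_p`) to `ℤ/p^k`. -/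
noncomputable def padicValuationSubringToZModPow (k : ℕ) : padicValuationSubring p →+* ZMod (p ^ k) :=
  (PadicInt.toZModPow k).comp (padicValuationSubringEquiv p).toRingHom

variable {V : Type*} {G : SimpleGraph V}

/-- ORDER-`k` `p`-ADIC REDUCTION (`p ≡ 3 (mod 4)`, `k ≥ 1`): every graph coordinatised in `ℚ_p²` with unit-distance edges is
`n`-colourable as soon as `G_k(p) = unitCircleGraph (ZMod (p^k))` is — `χ(ℚ_p²) ≤ χ(G_k(p))` for every `k`. -/
theorem colorable_of_padic_zmodPow (h4 : p % 4 = 3) {k : ℕ} (hk : k ≠ 0) (q : V → ℚ_[p] × ℚ_[p])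
    (hadj : ∀ ⦃v w : V⦄, G.Adj v w → ((q v).1 - (q w).1) ^ 2 + ((q v).2 - (q w).2) ^ 2 = 1) {n : ℕ}
    (hZ : (unitCircleGraph (ZMod (p ^ k))).Colorable n) : G.Colorable n :=
  haveI : Fact (1 < p ^ k) := fact_one_lt_prime_pow p hk
  colorable_of_valuationSubring_ringHom (padicValuationSubring p) q (padicResidue_sq_ne_neg_one p h4) hadj
    (padicValuationSubringToZModPow p k) hZ

/-- Transport along a ring homomorphism into `ℚ_p` (a number field with an unramified degree-one prime over `p`). -/
theorem colorable_of_ringHom_padic_zmodPow (h4 : p % 4 = 3) {k : ℕ} (hk : k ≠ 0) {K : Type*} [CommRing K]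
    (ι : K →+* ℚ_[p]) (q : V → K × K)
    (hadj : ∀ ⦃v w : V⦄, G.Adj v w → ((q v).1 - (q w).1) ^ 2 + ((q v).2 - (q w).2) ^ 2 = 1) {n : ℕ}
    (hZ : (unitCircleGraph (ZMod (p ^ k))).Colorable n) : G.Colorable n := by
  refine colorable_of_padic_zmodPow p h4 hk (fun v => (ι (q v).1, ι (q v).2)) ?_ hZ
  intro v w hvw
  have := congrArg ι (hadj hvw)
  simpa only [map_add, map_pow, map_sub, map_one] using this

/-- The `p`-adic plane itself: `χ(unitCircleGraph ℚ_p) ≤ χ(unitCircleGraph (ℤ/p^k))` for every `k ≥ 1` (`p ≡ 3 (mod 4)`). -/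
theorem unitCircleGraph_padic_colorable_of_zmodPow (h4 : p % 4 = 3) {k : ℕ} (hk : k ≠ 0) {n : ℕ}
    (hZ : (unitCircleGraph (ZMod (p ^ k))).Colorable n) : (unitCircleGraph ℚ_[p]).Colorable n :=
  colorable_of_padic_zmodPow p h4 hk (G := unitCircleGraph ℚ_[p]) id (fun _ _ h => h.2) hZ

/-- Conversely the bound is monotone in `k`: `unitCircleGraph (ZMod (p^(k+1))) → unitCircleGraph (ZMod (p^k))` along the
canonical ring map, so `χ(G_{k+1}(p)) ≤ χ(G_k(p))` — higher orders can only help. -/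
theorem unitCircleGraph_zmodPow_colorable_mono {k : ℕ} (hk : k ≠ 0) {n : ℕ}
    (hZ : (unitCircleGraph (ZMod (p ^ k))).Colorable n) : (unitCircleGraph (ZMod (p ^ (k + 1)))).Colorable n :=
  haveI : Fact (1 < p ^ k) := fact_one_lt_prime_pow p hk
  unitCircleGraph_colorable_of_ringHom (ZMod.castHom (pow_dvd_pow p (Nat.le_succ k)) (ZMod (p ^ k))) hZ

/-! ### Real multiquadratic fields all of whose generators are residues: `K_S ⊂ ℚ_p` -/

/-- If every `d ∈ S` is a non-zero quadratic residue mod `p` (odd), the real field `ℚ(√d : d ∈ S)` embeds in `ℚ_p` (Hensel). -/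
theorem nonempty_ringHom_multiSqrtField_padic (hp2 : p ≠ 2) (S : Finset ℕ) (hS : ∀ d ∈ S, IsQR p d) :
    Nonempty (multiSqrtField S →+* ℚ_[p]) := by
  let φ : multiSqrtField S →ₐ[ℚ] Ramified.Ω p := multiSqrtEmbedP p S
  let E : IntermediateField ℚ_[p] (Ramified.Ω p) := ⊥
  have hroots : ∀ d ∈ S, ∃ w ∈ E, w ^ 2 = (d : Ramified.Ω p) := by
    intro d hd
    obtain ⟨hd0, x, -, hx⟩ := hS d hd
    obtain ⟨r, hr⟩ := PadicOdd.exists_sq_eq_nat p hp2 d x hd0 hx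
    refine ⟨algebraMap ℚ_[p] (Ramified.Ω p) r, IntermediateField.mem_bot.mpr ⟨r, rfl⟩, ?_⟩
    rw [← map_pow, hr, map_natCast]
  have hmem : ∀ t, φ.toRingHom t ∈ E := fun t => multiSqrtEmbed_mem_of_roots S φ E hroots t
  let ψ : multiSqrtField S →+* E := φ.toRingHom.codRestrict E hmem
  exact ⟨(IntermediateField.botEquiv ℚ_[p] (Ramified.Ω p)).toAlgHom.toRingHom.comp ψ⟩

/-- ORDER-`k` `p`-ADIC CRITERION FOR PLANES (`p ≡ 3 (mod 4)`): if every `d ∈ S` is a non-zero residue mod `p` and `G_k(p)` is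
`n`-colourable for some `k ≥ 1`, then `χ(ℚ(√d : d ∈ S)²) ≤ n`. -/
theorem colorable_plane_of_isQR_zmodPow (h4 : p % 4 = 3) {k : ℕ} (hk : k ≠ 0) {n : ℕ}
    (hZ : (unitCircleGraph (ZMod (p ^ k))).Colorable n) (S : Finset ℕ) (hS : ∀ d ∈ S, IsQR p d) :
    (planeUnitDistanceGraph.induce (fieldPoints (multiSqrtField S))).Colorable n := by
  have hp2 : p ≠ 2 := by intro h; rw [h] at h4; norm_num at h4
  obtain ⟨ι⟩ := nonempty_ringHom_multiSqrtField_padic p hp2 S hS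
  refine colorable_of_ringHom_padic_zmodPow p h4 hk ι
    (G := planeUnitDistanceGraph.induce (fieldPoints (multiSqrtField S)))
    (fun q => (⟨(q : EuclideanSpace ℝ (Fin 2)) 0, q.2 0⟩, ⟨(q : EuclideanSpace ℝ (Fin 2)) 1, q.2 1⟩)) ?_ hZ
  intro v w hvw
  apply Subtype.ext
  push_cast
  exact sq_add_sq_eq_one_of_dist_eq_one hvw

/-- Single square root: `√d ∈ ℚ_p` (`d` a non-zero residue mod `p ≡ 3 (mod 4)`) and `G_k(p)` `n`-colourable ⇒ `χ(ℚ(√d)²) ≤ n`. -/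
theorem colorable_plane_sqrt_of_isQR_zmodPow (h4 : p % 4 = 3) {k : ℕ} (hk : k ≠ 0) {n : ℕ}
    (hZ : (unitCircleGraph (ZMod (p ^ k))).Colorable n) (d : ℕ) (hd : IsQR p d) :
    (planeUnitDistanceGraph.induce (fieldPoints ℚ⟮Real.sqrt d⟯)).Colorable n := by
  have h := colorable_plane_of_isQR_zmodPow p h4 hk hZ {d} (by simpa using hd)
  rwa [multiSqrtField_singleton] at h

end Padic

/-! ## The conditional row statements: what a `4`-colouring of one `G_k(11)` or `G_k(19)` would give -/

/-- Chromatic number from a sandwich: `¬ 3`-colourable and `4`-colourable ⇒ `χ = 4`. -/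
theorem chromaticNumber_eq_four_of_sandwich {W : Type*} {H : SimpleGraph W} (h3 : ¬ H.Colorable 3) (h4 : H.Colorable 4) :
    H.chromaticNumber = 4 := by
  apply le_antisymm h4.chromaticNumber_le
  by_contra hlt
  have hlt' : H.chromaticNumber < (3 : ℕ∞) + 1 := lt_of_not_ge hlt
  have hle : H.chromaticNumber ≤ (3 : ℕ) := Order.le_of_lt_add_one hlt'
  exact h3 (chromaticNumber_le_iff_colorable.mp hle)

/-- ROW 47, CONDITIONAL: a `4`-colouring of some `G_k(11) = unitCircleGraph (ZMod (11^k))` or of some `G_k(19)` (`k ≥ 1`;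
necessarily `k ≥ 3` resp. `k ≥ 2`) gives `χ(ℚ(√47)²) = 4` (`47 ≡ 5² (mod 11)`, `47 ≡ 3² (mod 19)`; lower bound `PlaneSqrt47Bounds`). -/
theorem chromaticNumber_plane_sqrt47_eq_four_of_zmodPow
    (h : (∃ k ≠ 0, (unitCircleGraph (ZMod (11 ^ k))).Colorable 4) ∨ (∃ k ≠ 0, (unitCircleGraph (ZMod (19 ^ k))).Colorable 4)) :
    (planeUnitDistanceGraph.induce (fieldPoints ℚ⟮Real.sqrt 47⟯)).chromaticNumber = 4 := by
  refine chromaticNumber_eq_four_of_sandwich not_colorable_three_plane_sqrt47 ?_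
  rcases h with ⟨k, hk, hZ⟩ | ⟨k, hk, hZ⟩
  · have := colorable_plane_sqrt_of_isQR_zmodPow 11 (by norm_num) hk hZ 47 (by decide)
    simpa using this
  · have := colorable_plane_sqrt_of_isQR_zmodPow 19 (by norm_num) hk hZ 47 (by decide)
    simpa using this

/-- ROW 311, CONDITIONAL: a `4`-colouring of some `G_k(11)` or `G_k(19)` gives `χ(ℚ(√311)²) = 4` (`311 ≡ 5² (mod 11)`, `311 ≡ 8² (mod 19)`). -/
theorem chromaticNumber_plane_sqrt311_eq_four_of_zmodPow
    (h : (∃ k ≠ 0, (unitCircleGraph (ZMod (11 ^ k))).Colorable 4) ∨ (∃ k ≠ 0, (unitCircleGraph (ZMod (19 ^ k))).Colorable 4)) :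
    (planeUnitDistanceGraph.induce (fieldPoints ℚ⟮Real.sqrt 311⟯)).chromaticNumber = 4 := by
  refine chromaticNumber_eq_four_of_sandwich not_colorable_three_plane_sqrt311 ?_
  rcases h with ⟨k, hk, hZ⟩ | ⟨k, hk, hZ⟩
  · have := colorable_plane_sqrt_of_isQR_zmodPow 11 (by norm_num) hk hZ 311 (by decide)
    simpa using this
  · have := colorable_plane_sqrt_of_isQR_zmodPow 19 (by norm_num) hk hZ 311 (by decide)
    simpa using this

/-- ROW 335, CONDITIONAL: a `4`-colouring of some `G_k(11)` gives `χ(ℚ(√335)²) = 4` (`335 ≡ 4² (mod 11)`; `335 ≡ 12` is a non-residue mod 19). -/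
theorem chromaticNumber_plane_sqrt335_eq_four_of_zmodPow (h : ∃ k ≠ 0, (unitCircleGraph (ZMod (11 ^ k))).Colorable 4) :
    (planeUnitDistanceGraph.induce (fieldPoints ℚ⟮Real.sqrt 335⟯)).chromaticNumber = 4 := by
  refine chromaticNumber_eq_four_of_sandwich not_colorable_three_plane_sqrt335 ?_
  obtain ⟨k, hk, hZ⟩ := h
  have := colorable_plane_sqrt_of_isQR_zmodPow 11 (by norm_num) hk hZ 335 (by decide)
  simpa using this

/-- ROWS 383 (`≡ 3² mod 11`), 83 and 215 (`≡ 8², 5² mod 19`): the same hypothesis gives `χ ≤ 4` there (their lower bounds are `3`). -/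
theorem colorable_four_plane_sqrt_383_83_215_of_zmodPow :
    ((∃ k ≠ 0, (unitCircleGraph (ZMod (11 ^ k))).Colorable 4) →
        (planeUnitDistanceGraph.induce (fieldPoints ℚ⟮Real.sqrt 383⟯)).Colorable 4) ∧
    ((∃ k ≠ 0, (unitCircleGraph (ZMod (19 ^ k))).Colorable 4) →
        (planeUnitDistanceGraph.induce (fieldPoints ℚ⟮Real.sqrt 83⟯)).Colorable 4 ∧
        (planeUnitDistanceGraph.induce (fieldPoints ℚ⟮Real.sqrt 215⟯)).Colorable 4) := by
  refine ⟨?_, ?_⟩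
  · rintro ⟨k, hk, hZ⟩
    have := colorable_plane_sqrt_of_isQR_zmodPow 11 (by norm_num) hk hZ 383 (by decide)
    simpa using this
  · rintro ⟨k, hk, hZ⟩
    have h83 := colorable_plane_sqrt_of_isQR_zmodPow 19 (by norm_num) hk hZ 83 (by decide)
    have h215 := colorable_plane_sqrt_of_isQR_zmodPow 19 (by norm_num) hk hZ 215 (by decide)
    exact ⟨by simpa using h83, by simpa using h215⟩


/-! ## The `p`-adic planes themselves: `χ(ℚ₃²) = 3`, `χ(ℚ₇²) = 4`, `χ(ℚ₁₁²), χ(ℚ₁₉²) ∈ {4, 5}` -/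

section PadicPlanes

/-- A real field `K ⊂ ℝ` with a ring homomorphism into a nontrivial commutative ring `B` maps its plane's unit-distance graph
homomorphically to `unitCircleGraph B` (coordinates through `ι`; `UnitCircleGraph.homUnitCircleGraphOfRingHom`). -/
noncomputable def homPlaneUnitCircleGraphOfRingHom (K : IntermediateField ℚ ℝ) {B : Type*} [CommRing B] [Nontrivial B]
    (ι : K →+* B) : planeUnitDistanceGraph.induce (fieldPoints K) →g unitCircleGraph B :=
  homUnitCircleGraphOfRingHom (G := planeUnitDistanceGraph.induce (fieldPoints K))
    (fun q => (⟨(q : EuclideanSpace ℝ (Fin 2)) 0, q.2 0⟩, ⟨(q : EuclideanSpace ℝ (Fin 2)) 1, q.2 1⟩))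
    (by
      intro v w hvw
      apply Subtype.ext
      push_cast
      exact sq_add_sq_eq_one_of_dist_eq_one hvw) ι

/-- LOWER-BOUND TRANSPORT: if `χ(K²) > n` for a real field `K` embedding in `B`, then `χ(unitCircleGraph B) > n`. -/
theorem not_colorable_unitCircleGraph_of_ringHom (K : IntermediateField ℚ ℝ) {B : Type*} [CommRing B] [Nontrivial B]
    (ι : K →+* B) {n : ℕ} (hK : ¬ (planeUnitDistanceGraph.induce (fieldPoints K)).Colorable n) :
    ¬ (unitCircleGraph B).Colorable n :=
  fun h => hK (h.of_hom (homPlaneUnitCircleGraphOfRingHom K ι))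

/-- `ℚ(√d) ↪ ℚ_p` for `d` a non-zero residue modulo the odd prime `p`. -/
theorem nonempty_ringHom_sqrt_padic (p : ℕ) [Fact p.Prime] (hp2 : p ≠ 2) (d : ℕ) (hd : IsQR p d) :
    Nonempty (ℚ⟮Real.sqrt d⟯ →+* ℚ_[p]) := by
  have h := nonempty_ringHom_multiSqrtField_padic p hp2 {d} (by simpa using hd)
  rwa [multiSqrtField_singleton] at h

/-- Chromatic number from a sandwich: `¬ 2`-colourable and `3`-colourable ⇒ `χ = 3`. -/
theorem chromaticNumber_eq_three_of_sandwich {W : Type*} {H : SimpleGraph W} (h2 : ¬ H.Colorable 2) (h3 : H.Colorable 3) :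
    H.chromaticNumber = 3 := by
  apply le_antisymm h3.chromaticNumber_le
  by_contra hlt
  have hlt' : H.chromaticNumber < (2 : ℕ∞) + 1 := lt_of_not_ge hlt
  have hle : H.chromaticNumber ≤ (2 : ℕ) := Order.le_of_lt_add_one hlt'
  exact h2 (chromaticNumber_le_iff_colorable.mp hle)

/-- THE 3-ADIC PLANE: `χ(unitCircleGraph ℚ₃) = 3` (upper: reduction mod 3; lower: `ℚ(√7) ⊂ ℚ₃`, `7 ≡ 1 (mod 3)`, and `ℚ(√7)²`
has an odd cycle, `7 ≡ 3 (mod 4)`, `OddCycles.lean`). -/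
theorem chromaticNumber_unitCircleGraph_padic3 : (unitCircleGraph ℚ_[3]).chromaticNumber = 3 := by
  obtain ⟨ι⟩ := nonempty_ringHom_sqrt_padic 3 (by norm_num) 7 (by decide)
  exact chromaticNumber_eq_three_of_sandwich
    (not_colorable_unitCircleGraph_of_ringHom _ ι (by simpa using not_colorable_two_plane_sqrt 7 (by norm_num)))
    unitCircleGraph_padic3_colorable_three

/-- THE 7-ADIC PLANE: `χ(unitCircleGraph ℚ₇) = 4` (upper: reduction mod 7; lower: `ℚ(√11) ⊂ ℚ₇`, `11 ≡ 2² (mod 7)`, and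
`χ(ℚ(√11)²) = 4`, udg g12's kernel witness `PlaneSqrt11Four.lean`). -/
theorem chromaticNumber_unitCircleGraph_padic7 : (unitCircleGraph ℚ_[7]).chromaticNumber = 4 := by
  obtain ⟨ι⟩ := nonempty_ringHom_sqrt_padic 7 (by norm_num) 11 (by decide)
  exact chromaticNumber_eq_four_of_sandwich
    (not_colorable_unitCircleGraph_of_ringHom _ ι (by simpa using not_colorable_three_plane_sqrt11))
    unitCircleGraph_padic7_colorable_four

/-- THE 11-ADIC PLANE: `4 ≤ χ(unitCircleGraph ℚ₁₁) ≤ 5` (lower: `ℚ(√47) ⊂ ℚ₁₁` and udg g13's witness `W₄₇`; upper: reduction mod 11).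
Which value holds is OPEN; `= 4` would close the rows `47, 311, 335` (next theorems), `= 5` would need a 5-chromatic unit-distance
graph over a number field inside `ℚ₁₁` (none of the known 5-chromatic fields — they contain `√11` or `√2` — embeds). -/
theorem chromaticNumber_unitCircleGraph_padic11_bounds :
    4 ≤ (unitCircleGraph ℚ_[11]).chromaticNumber ∧ (unitCircleGraph ℚ_[11]).chromaticNumber ≤ 5 := by
  obtain ⟨ι⟩ := nonempty_ringHom_sqrt_padic 11 (by norm_num) 47 (by decide)
  refine ⟨?_, unitCircleGraph_padic11_colorable_five.chromaticNumber_le⟩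
  have h3 := not_colorable_unitCircleGraph_of_ringHom _ ι (by simpa using not_colorable_three_plane_sqrt47)
  by_contra hlt
  have hlt' : (unitCircleGraph ℚ_[11]).chromaticNumber < (3 : ℕ∞) + 1 := lt_of_not_ge hlt
  exact h3 (chromaticNumber_le_iff_colorable.mp (Order.le_of_lt_add_one hlt'))

/-- THE 19-ADIC PLANE: `4 ≤ χ(unitCircleGraph ℚ₁₉) ≤ 5` (lower: `ℚ(√47) ⊂ ℚ₁₉`, `47 ≡ 3² (mod 19)`; upper: reduction mod 19). -/
theorem chromaticNumber_unitCircleGraph_padic19_bounds :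
    4 ≤ (unitCircleGraph ℚ_[19]).chromaticNumber ∧ (unitCircleGraph ℚ_[19]).chromaticNumber ≤ 5 := by
  obtain ⟨ι⟩ := nonempty_ringHom_sqrt_padic 19 (by norm_num) 47 (by decide)
  refine ⟨?_, unitCircleGraph_padic19_colorable_five.chromaticNumber_le⟩
  have h3 := not_colorable_unitCircleGraph_of_ringHom _ ι (by simpa using not_colorable_three_plane_sqrt47)
  by_contra hlt
  have hlt' : (unitCircleGraph ℚ_[19]).chromaticNumber < (3 : ℕ∞) + 1 := lt_of_not_ge hlt
  exact h3 (chromaticNumber_le_iff_colorable.mp (Order.le_of_lt_add_one hlt'))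

/-- `χ(ℚ(√d)²) ≤ χ(ℚ_p²)` for `d` a residue mod `p`: a `4`-colouring of the whole `11`-adic plane (by reduction or not) closes the rows
`47, 311, 335` at `4`; one of the `19`-adic plane closes `47, 311`. -/
theorem chromaticNumber_plane_sqrt_47_311_335_eq_four_of_padic :
    ((unitCircleGraph ℚ_[11]).Colorable 4 →
      (planeUnitDistanceGraph.induce (fieldPoints ℚ⟮Real.sqrt 47⟯)).chromaticNumber = 4 ∧
      (planeUnitDistanceGraph.induce (fieldPoints ℚ⟮Real.sqrt 311⟯)).chromaticNumber = 4 ∧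
      (planeUnitDistanceGraph.induce (fieldPoints ℚ⟮Real.sqrt 335⟯)).chromaticNumber = 4) ∧
    ((unitCircleGraph ℚ_[19]).Colorable 4 →
      (planeUnitDistanceGraph.induce (fieldPoints ℚ⟮Real.sqrt 47⟯)).chromaticNumber = 4 ∧
      (planeUnitDistanceGraph.induce (fieldPoints ℚ⟮Real.sqrt 311⟯)).chromaticNumber = 4) := by
  refine ⟨fun h11 => ⟨?_, ?_, ?_⟩, fun h19 => ⟨?_, ?_⟩⟩
  · obtain ⟨ι⟩ := nonempty_ringHom_sqrt_padic 11 (by norm_num) 47 (by decide)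
    exact chromaticNumber_eq_four_of_sandwich not_colorable_three_plane_sqrt47
      (h11.of_hom (homPlaneUnitCircleGraphOfRingHom _ ι))
  · obtain ⟨ι⟩ := nonempty_ringHom_sqrt_padic 11 (by norm_num) 311 (by decide)
    exact chromaticNumber_eq_four_of_sandwich not_colorable_three_plane_sqrt311
      (h11.of_hom (homPlaneUnitCircleGraphOfRingHom _ ι))
  · obtain ⟨ι⟩ := nonempty_ringHom_sqrt_padic 11 (by norm_num) 335 (by decide)
    exact chromaticNumber_eq_four_of_sandwich not_colorable_three_plane_sqrt335
      (h11.of_hom (homPlaneUnitCircleGraphOfRingHom _ ι))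
  · obtain ⟨ι⟩ := nonempty_ringHom_sqrt_padic 19 (by norm_num) 47 (by decide)
    exact chromaticNumber_eq_four_of_sandwich not_colorable_three_plane_sqrt47
      (h19.of_hom (homPlaneUnitCircleGraphOfRingHom _ ι))
  · obtain ⟨ι⟩ := nonempty_ringHom_sqrt_padic 19 (by norm_num) 311 (by decide)
    exact chromaticNumber_eq_four_of_sandwich not_colorable_three_plane_sqrt311
      (h19.of_hom (homPlaneUnitCircleGraphOfRingHom _ ι))

end PadicPlanes

end Summit.Ventures.DiscreteObjects.UnitDistance

end
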